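import Summits.ResolutionOfSingularities.ResolutionOfSingularities.Theorems.PurelyInseparableDim4ResConePairVirtualChain
import Summits.ResolutionOfSingularities.ResolutionOfSingularities.Theorems.PurelyInseparableDim4ResConeDInfTT
import Summits.ResolutionOfSingularities.ResolutionOfSingularities.Theorems.PurelyInseparableDim4ResConeSatellitePair
import Summits.ResolutionOfSingularities.ResolutionOfSingularities.Theorems.PurelyInseparableDim4TschirnhausChain
import Summits.ResolutionOfSingularities.ResolutionOfSingularities.Theorems.PurelyInseparableDim4SupportVirtualStep
import HarnessLib
import HarnessLib.Audit.Tags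

/-!
# Purely inseparable four-folds — EVERY CONSTANT-SHADE `e_G = 2` TAIL HAS, FROM A LATE SATELLITE TIME, AN HONEST PARTNER CONFINED TO
# ITS OWN BOUNDARY SUPPORT, FOR EVERY PRIME `p` AND EVERY SHADE `d` (K2(p) lane, slice C, rung-1 generic re-presentation: the
# letter-set form of res-dim4-p-5 g5's `pair_representation_of_support_le_two`; seat res-dim4-p-1 g6)

[OURS · counted 0 · cell `res-dim4-pi` · K2(p) lane (holder lineage res-dim4-p-12; rung-1 generic bricks «no `7` in a signature»,
desk WORD #193 (δ)) · seat res-dim4-p-1 g6, successor by lineage of the light-lossy kernel seat p-1 g5 (`…ResConeLightTail`,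
p705856).]  Nothing here proves K2(p) = `RidgeBudget.NoAboveFloorTrap p p` for any `p`, `NoIsolatedTrap p p`, the
Cossart–Jannsen–Saito theorem or resolution of singularities in dimension ≥ 4 / characteristic `p` — NOT proved; this file is a
REDUCTION (an honest re-presentation exists), not a kill.  AI kernel work, weaker than expert review.

THE REDUCTION.  Let `c` be a witnessed isolated above-floor `Step0 p` chain with `x^{r₀} ∣ F₀`, of constant shade `d` and polar-kernel
rank `e_G ≡ 2` from `k₀` — NO hypothesis on its boundary support.  By the free-tail theorem a SATELLITE step `k ≥ N` exists for every
`N ≥ k₀`; put `kₑ := k + 2` and `S := supp r_{kₑ}` (it contains the satellite pair `j k ≠ j (k+1)`).  Then there is an HONEST witnessed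
isolated above-floor `Step0 p` chain `c′` with `c′ 0 = c kₑ`, `x^{r₀′} ∣ F₀′`, constant shade `d`, `e_G ≡ 2`, whose chart letters all lie
in `S`, whose letters outside `S` are NEVER boundary letters, which is TT for `S` at every time (no non-zero kernel vector vanishes on
`S`), and whose weights are the real weights renamed: `(c′ t).r = (c (kₑ + t)).r ∘ π_t`.  For `#S ≤ 2` this is p-5's pair-confined
partner; for `#S = 3` «the fourth letter stays passive for ever» (res-dim4-typ-1 g4, bus 2026-08-29 08:48Z); `#S = 4` is allowed and
then says nothing new.
* §1 **`support_virtual_chain (p) (S)`** — the ABSTRACT `S`-confined virtual chain from ANY step-invariant `Inv` (SHAPE: isolated,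
  `ord₀ = |r| + d > p`, `e_G = 2`, weights inside `S`, `x^r ∣ F`; STEP: some chart `ℓ ∈ S`, translation `β` with `β ℓ = 0`, keeps `Inv`):
  `Nat.rec` + `Classical.epsilon`, verbatim res-dim4-p-5 g5's `pair_virtual_chain` (p708715) with `{a, a′} ↦ S`.
* §2 `degree_eq_card_support_of_le_one`, `apply_eq_one_of_confined` — light-weight numerics for consumers (a weight vector with all
  weights `≤ 1`, confined to `S` and of total weight `#S` weighs `1` at every letter of `S`).
* §3 **`support_entry_of_satellite (p)`** — after a satellite step `k ≥ k₀`: `j k ≠ j (k+1)` both lie in `supp r_{k+2}`, `c (k+2)` is TT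
  for `supp r_{k+2}` (res-dim4-p-5's `tt_of_satellite`, p707227, for the pair — a fortiori for any set containing it) and clean
  (`FrameChange.deletePthPowers_step_F`).
* §4 **`support_representation_of_satellite (p)`** — entry → res-dim4-typ-1 g4's `SwapTransport.supportInv_refl p S` → §1 fed by
  `SwapTransport.support_virtual_step p S` (p709996) at every real step (band `p < o < 2p` by `chain_band`, `x^r ∣ F` by
  `IsolatedBand.isolated_chain_forall_le`, shade kept, isolation and `e_G` from the tail hypotheses) → the `S`-confined partner with
  the weight correspondence and TT_S exported.
First consumer: `…ResConeLightTripleAllPrimes` (this seat): the LIGHT TRIPLE `(1,1,1)` at `(p, p−2)` — there `#S = 3`, the partner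
weighs `1` on all of `S` for ever (§2), so its translations avoid `S`: it is LOSS-FREE and res-dim4-p-5 g3's C13 `no_lossfree_tail p`
ends it.
[cite: CossartJannsenSaito2020, Thm. 3.10(4), Thm. 3.14, Thm. 9.3] [cite: Hauser2010, §§F–G (chart expressions of a point blowup; cleaning)]
bears_on: LADDER-RESOLUTION:D157-DOOR2 (res-dim4-pi · K2(p) = `RidgeBudget.NoAboveFloorTrap p p` · slice C · rung-1 generic
support-confined re-presentation, every prime, every shade).  Supports stmt-ResolutionOfSingularities-16155 (helper).
-/

set_option linter.dupNamespace false -- mandated namespace of this single-conjunct summit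

noncomputable section

namespace Summit.ResolutionOfSingularities.ResolutionOfSingularities.Theorems.PIDim4

namespace ResCone

open MvPolynomial Finset
open Literature.AlgebraicGeometry.Resolution
open Literature.AlgebraicGeometry.Resolution.CentreBlowup
open Literature.AlgebraicGeometry.Resolution.Hauser2010
open Literature.AlgebraicGeometry.Resolution.HauserPerlega2019

variable {K : Type} [Field K] [DecidableEq K] (p : ℕ)

/-! ## §1 The abstract `S`-confined virtual chain -/

/-- **THE ABSTRACT `S`-CONFINED VIRTUAL CHAIN, every prime `p`, every shade `d`, every letter set `S`.**  Let
`Inv : ℕ → State K → Prop` be any predicate such that (SHAPE) every `Inv`-state is isolated, has `ord₀ F = |r| + d > p`, `e_G = 2`,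
boundary letters in `S` and `x^r ∣ F`; and (STEP) from every `Inv t B` some point step charted in `S` (`ℓ ∈ S`, `β ℓ = 0`) leads to
`Inv (t+1) (step p univ ℓ β B)`.  Then from any `Inv 0 B₀` there is a chain `c′` with `c′ 0 = B₀`, `Inv t (c′ t)`, witnessed by charts
in `S` (`c′ (t+1) = step p univ (j′ t) (b′ t) (c′ t)`, `j′ t ∈ S`, `b′ t (j′ t) = 0`), which is an isolated above-floor `Step0 p` chain
with `x^{r₀} ∣ F₀`, constant shade `d`, `e_G ≡ 2`, and no boundary letter outside `S`, ever.  (res-dim4-p-5 g5's `pair_virtual_chain`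
with `{a, a′} ↦ S`; `Nat.rec` + `Classical.epsilon`.) [OURS · conditional on `hvstep`]
[cite: CossartJannsenSaito2020, Thm. 3.14] [cite: Hauser2010, §§F–G (chart expressions of a point blowup; cleaning)] -/
theorem support_virtual_chain (S : Finset (Fin 4)) {d : ℕ} {Inv : ℕ → State K → Prop} {B₀ : State K} (hentry : Inv 0 B₀)
    (hshape : ∀ t B, Inv t B → IsIsolated p B.F ∧ ordZero B.F = ((B.r.degree + d : ℕ) : ℕ∞) ∧ p < B.r.degree + d ∧
      Module.finrank K (resVertex B) = 2 ∧ (∀ i, i ∉ S → B.r i = 0) ∧ (∀ e ∈ B.F.support, B.r ≤ e))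
    (hvstep : ∀ t B, Inv t B → ∃ (ℓ : Fin 4) (β : Fin 4 → K), ℓ ∈ S ∧ β ℓ = 0 ∧
      Inv (t + 1) (CentreBlowup.step p Finset.univ ℓ β B)) :
    ∃ (c' : ℕ → State K) (j' : ℕ → Fin 4) (b' : ℕ → Fin 4 → K), c' 0 = B₀ ∧ (∀ t, Inv t (c' t)) ∧
      (∀ t, IsIsolated p (c' t).F ∧ Step0 p (c' t) (c' (t + 1))) ∧ FreeTail.IsWitnessedChain p c' j' b' ∧
      (∀ e ∈ (c' 0).F.support, (c' 0).r ≤ e) ∧ (∀ t, ordZero (c' t).F ≠ p) ∧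
      (∀ t, 0 ≤ t → (c' t).shade = (d : ℕ∞)) ∧ (∀ t, 0 ≤ t → Module.finrank K (resVertex (c' t)) = 2) ∧
      (∀ t, j' t ∈ S) ∧ (∀ t, ∀ i, i ∉ S → (c' t).r i = 0) := by
  -- (1) the step predicate and the recursion
  obtain ⟨Q, hQ⟩ : ∃ Q : ℕ → State K → Fin 4 × (Fin 4 → K) → Prop,
      ∀ t B x, Q t B x ↔ (x.1 ∈ S ∧ x.2 x.1 = 0 ∧ Inv (t + 1) (CentreBlowup.step p Finset.univ x.1 x.2 B)) :=
    ⟨_, fun _ _ _ => Iff.rfl⟩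
  obtain ⟨sq, hd0, hds⟩ : ∃ sq : ℕ → State K, sq 0 = B₀ ∧
      ∀ t, sq (t + 1) = CentreBlowup.step p Finset.univ (Classical.epsilon (Q t (sq t))).1
        (Classical.epsilon (Q t (sq t))).2 (sq t) :=
    ⟨fun t => Nat.rec B₀ (fun t dt => CentreBlowup.step p Finset.univ (Classical.epsilon (Q t dt)).1
      (Classical.epsilon (Q t dt)).2 dt) t, rfl, fun _ => rfl⟩
  -- (2) the invariant along the recursion
  have hINV : ∀ t, Inv t (sq t) := by
    intro t
    induction t with
    | zero => rw [hd0]; exact hentry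
    | succ t ih =>
      have hex : ∃ x, Q t (sq t) x := by
        obtain ⟨ℓ, β, hℓ, hβ, h⟩ := hvstep t (sq t) ih
        exact ⟨(ℓ, β), (hQ t (sq t) (ℓ, β)).mpr ⟨hℓ, hβ, h⟩⟩
      obtain ⟨-, -, h⟩ := (hQ t (sq t) _).mp (Classical.epsilon_spec hex)
      rw [hds t]
      exact h
  have hspec : ∀ t, Q t (sq t) (Classical.epsilon (Q t (sq t))) := fun t => by
    have hex : ∃ x, Q t (sq t) x := by
      obtain ⟨ℓ, β, hℓ, hβ, h⟩ := hvstep t (sq t) (hINV t)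
      exact ⟨(ℓ, β), (hQ t (sq t) (ℓ, β)).mpr ⟨hℓ, hβ, h⟩⟩
    exact Classical.epsilon_spec hex
  -- (3) the packaging
  have hℓ : ∀ t, (Classical.epsilon (Q t (sq t))).1 ∈ S := fun t => ((hQ t (sq t) _).mp (hspec t)).1
  have hβℓ : ∀ t, (Classical.epsilon (Q t (sq t))).2 (Classical.epsilon (Q t (sq t))).1 = 0 := fun t =>
    ((hQ t (sq t) _).mp (hspec t)).2.1
  have hisoV : ∀ t, IsIsolated p (sq t).F := fun t => (hshape t (sq t) (hINV t)).1
  have hoV : ∀ t, ordZero (sq t).F = (((sq t).r.degree + d : ℕ) : ℕ∞) := fun t => (hshape t (sq t) (hINV t)).2.1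
  have hpV : ∀ t, p < (sq t).r.degree + d := fun t => (hshape t (sq t) (hINV t)).2.2.1
  have heV : ∀ t, Module.finrank K (resVertex (sq t)) = 2 := fun t => (hshape t (sq t) (hINV t)).2.2.2.1
  have hpassV : ∀ t, ∀ i, i ∉ S → (sq t).r i = 0 := fun t => (hshape t (sq t) (hINV t)).2.2.2.2.1
  have hdivV : ∀ t, ∀ e ∈ (sq t).F.support, (sq t).r ≤ e := fun t => (hshape t (sq t) (hINV t)).2.2.2.2.2
  have hple : ∀ t, ((p : ℕ) : ℕ∞) ≤ ordAlong Finset.univ (sq t).F := fun t => by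
    rw [ordAlong_univ, hoV t]
    exact_mod_cast (hpV t).le
  have hequi : ∀ t, IsEquimultiplePoint p Finset.univ (Classical.epsilon (Q t (sq t))).1 (Classical.epsilon (Q t (sq t))).2
      (sq t) := fun t => by
    rw [Equimultiple.isEquimultiplePoint_iff_le_ordZero_step, ← hds t, hoV (t + 1)]
    exact_mod_cast (hpV (t + 1)).le
  have hne : ∀ t, (CentreBlowup.step p Finset.univ (Classical.epsilon (Q t (sq t))).1 (Classical.epsilon (Q t (sq t))).2
      (sq t)).F ≠ 0 := fun t h0 => by
    have h := hoV (t + 1)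
    rw [hds t, h0, ordZero_zero] at h
    exact ENat.top_ne_coe _ h
  have hfloorV : ∀ t, ordZero (sq t).F ≠ p := fun t h => by
    rw [hoV t] at h
    have := hpV t
    have h' : (sq t).r.degree + d = p := by exact_mod_cast h
    omega
  have hshadeV : ∀ t, (sq t).shade = (d : ℕ∞) := fun t => by
    rw [BandShade.shade_eq_coe (hoV t)]
    congr 1
    omega
  refine ⟨sq, fun t => (Classical.epsilon (Q t (sq t))).1, fun t => (Classical.epsilon (Q t (sq t))).2, hd0, hINV,
    fun t => ⟨hisoV t, hple t, (Classical.epsilon (Q t (sq t))).1, (Classical.epsilon (Q t (sq t))).2, Finset.mem_univ _,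
      hβℓ t, hequi t, hne t, hds t⟩,
    fun t => ⟨hple t, hβℓ t, hequi t, hne t, hds t⟩, ?_, hfloorV, fun t _ => hshadeV t, fun t _ => heV t, hℓ, hpassV⟩
  rw [hd0]
  have := hdivV 0
  rwa [hd0] at this

/-! ## §2 Light-weight numerics for consumers -/

omit [DecidableEq K] in
/-- A weight vector with all weights `≤ 1` has total weight the size of its support. [folklore] -/
theorem degree_eq_card_support_of_le_one {f : Fin 4 →₀ ℕ} (h1 : ∀ i, f i ≤ 1) : f.degree = f.support.card := by
  rw [Finsupp.degree_apply, Finset.card_eq_sum_ones]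
  refine Finset.sum_congr rfl fun i hi => ?_
  have := h1 i
  have := Finsupp.mem_support_iff.mp hi
  omega

omit [DecidableEq K] in
/-- A weight vector with all weights `≤ 1`, confined to a letter set `S` and of total weight `#S`, weighs `1` at EVERY letter of `S`
(its support is all of `S`). [folklore] -/
theorem apply_eq_one_of_confined {f : Fin 4 →₀ ℕ} {S : Finset (Fin 4)} (h1 : ∀ i, f i ≤ 1)
    (hconf : ∀ i, i ∉ S → f i = 0) (hdeg : f.degree = S.card) {i : Fin 4} (hi : i ∈ S) : f i = 1 := by
  have hsub : f.support ⊆ S := fun l hl => by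
    by_contra hlS
    exact (Finsupp.mem_support_iff.mp hl) (hconf l hlS)
  have hcard : S.card ≤ f.support.card := by rw [← degree_eq_card_support_of_le_one h1, hdeg]
  have heq : f.support = S := Finset.eq_of_subset_of_card_le hsub hcard
  have hne : f i ≠ 0 := Finsupp.mem_support_iff.mp (heq ▸ hi)
  have := h1 i
  omega

/-! ## §3 The entry after a satellite step -/

variable [Fact p.Prime] [CharP K p]

omit [CharP K p] in
/-- **THE SUPPORT ENTRY, every prime `p`, every shade**: on a constant-`(d, e_G = 2)` tail, after a satellite step `k ≥ k₀` the two
chart letters `j k ≠ j (k+1)` are boundary letters of `c (k+2)`, the state `c (k+2)` is TT for its own boundary support (no non-zero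
kernel vector vanishes on `supp r_{k+2}` — res-dim4-p-5's `tt_of_satellite` for the pair, a fortiori), and it is clean. [OURS]
[cite: CossartJannsenSaito2020, Thm. 3.10(4), Thm. 3.14, Thm. 9.3] -/
theorem support_entry_of_satellite {c : ℕ → State K} {j : ℕ → Fin 4} {b : ℕ → Fin 4 → K}
    (hc : ∀ k, IsIsolated p (c k).F ∧ Step0 p (c k) (c (k + 1))) (hw : FreeTail.IsWitnessedChain p c j b)
    (hr0 : ∀ e ∈ (c 0).F.support, (c 0).r ≤ e) (hfloor : ∀ k, ordZero (c k).F ≠ p) {k₀ d : ℕ}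
    (hshade : ∀ k, k₀ ≤ k → (c k).shade = (d : ℕ∞)) (he : ∀ k, k₀ ≤ k → Module.finrank K (resVertex (c k)) = 2)
    {k : ℕ} (hk : k₀ ≤ k) (hsat : FreeTail.IsSatellite j b k) :
    j k ≠ j (k + 1) ∧ j k ∈ (c (k + 2)).r.support ∧ j (k + 1) ∈ (c (k + 2)).r.support ∧
      (∀ v ∈ resVertex (c (k + 2)), (∀ i ∈ (c (k + 2)).r.support, v i = 0) → v = 0) ∧
      deletePthPowers p (c (k + 2)).F = (c (k + 2)).F := by
  have hstep : ∀ k, c (k + 1) = CentreBlowup.step p Finset.univ (j k) (b k) (c k) := fun k => (hw k).2.2.2.2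
  -- newborn weights are `o − p ≥ 1`
  have hnew : ∀ m, 1 ≤ (c (m + 1)).r (j m) := by
    intro m
    obtain ⟨o, ho, hpo, -⟩ := chain_band p hc hfloor m
    rw [hstep m, step_r_univ' p (j m) (b m) (c m) ho, Finsupp.coe_update, Function.update_self]
    omega
  have h1 : 1 ≤ (c (k + 2)).r (j (k + 1)) := hnew (k + 1)
  have h2 : 1 ≤ (c (k + 2)).r (j k) := by
    obtain ⟨o, ho, -, -⟩ := chain_band p hc hfloor (k + 1)
    have h := hnew k
    rw [hstep (k + 1), step_r_univ' p (j (k + 1)) (b (k + 1)) (c (k + 1)) ho, Finsupp.coe_update,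
      Function.update_of_ne hsat.1.symm, Finsupp.filter_apply, if_pos hsat.2]
    exact h
  have hTT := tt_of_satellite p hc hw hr0 hfloor hshade he hk hsat
  refine ⟨hsat.1.symm, Finsupp.mem_support_iff.mpr (by omega), Finsupp.mem_support_iff.mpr (by omega),
    fun v hv hvS => hTT v hv (hvS _ (Finsupp.mem_support_iff.mpr (by omega)))
      (hvS _ (Finsupp.mem_support_iff.mpr (by omega))), ?_⟩
  rw [hstep (k + 1)]
  exact FrameChange.deletePthPowers_step_F p Finset.univ (j (k + 1)) (b (k + 1)) (c (k + 1))

/-! ## §4 The support-confined re-presentation -/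

/-- **SUPPORT-CONFINED RE-PRESENTATION OF EVERY CONSTANT-SHADE `e_G = 2` TAIL, every prime `p`, every shade `d`.**  On a witnessed
isolated above-floor `Step0 p` chain with `x^{r₀} ∣ F₀`, constant shade `d` and `e_G ≡ 2` from `k₀` (NO support hypothesis): for every
`N ≥ k₀` there are an entry time `kₑ ≥ N` and an HONEST witnessed isolated above-floor `Step0 p` chain `c′` with `x^{r₀′} ∣ F₀′`,
`c′ 0 = c kₑ`, constant shade `d`, `e_G ≡ 2`, weights `(c′ t).r = (c (kₑ + t)).r ∘ π_t` for permutations `π_t`, no boundary letter outside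
`S := supp r_{kₑ}` ever, chart letters in `S`, and TT for `S` at every time.  (Entry `support_entry_of_satellite`, invariant
res-dim4-typ-1 g4's `INV_{p,S}` through `supportInv_refl` / `support_virtual_step`, assembly `support_virtual_chain`.) [OURS]
[cite: CossartJannsenSaito2020, Thm. 3.10(4), Thm. 3.14, Thm. 9.3] [cite: Hauser2010, §§F–G (chart expressions of a point blowup; cleaning)] -/
theorem support_representation_of_satellite {c : ℕ → State K} {j : ℕ → Fin 4} {b : ℕ → Fin 4 → K}
    (hc : ∀ k, IsIsolated p (c k).F ∧ Step0 p (c k) (c (k + 1))) (hw : FreeTail.IsWitnessedChain p c j b)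
    (hr0 : ∀ e ∈ (c 0).F.support, (c 0).r ≤ e) (hfloor : ∀ k, ordZero (c k).F ≠ p) {k₀ d : ℕ}
    (hshade : ∀ k, k₀ ≤ k → (c k).shade = (d : ℕ∞)) (he : ∀ k, k₀ ≤ k → Module.finrank K (resVertex (c k)) = 2)
    {N : ℕ} (hN : k₀ ≤ N) :
    ∃ (kₑ : ℕ) (c' : ℕ → State K) (j' : ℕ → Fin 4) (b' : ℕ → Fin 4 → K), N ≤ kₑ ∧ c' 0 = c kₑ ∧
      (∀ t, ∃ π : Equiv.Perm (Fin 4), (c' t).r = Finsupp.mapDomain (Equiv.symm π) (c (kₑ + t)).r) ∧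
      (∀ t, ∀ i, i ∉ (c kₑ).r.support → (c' t).r i = 0) ∧ (∀ t, j' t ∈ (c kₑ).r.support) ∧
      (∀ t, ∀ v ∈ resVertex (c' t), (∀ i ∈ (c kₑ).r.support, v i = 0) → v = 0) ∧
      (∀ t, IsIsolated p (c' t).F ∧ Step0 p (c' t) (c' (t + 1))) ∧ FreeTail.IsWitnessedChain p c' j' b' ∧
      (∀ e ∈ (c' 0).F.support, (c' 0).r ≤ e) ∧ (∀ t, ordZero (c' t).F ≠ p) ∧
      (∀ t, 0 ≤ t → (c' t).shade = (d : ℕ∞)) ∧ (∀ t, 0 ≤ t → Module.finrank K (resVertex (c' t)) = 2) := by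
  have hstep : ∀ k, c (k + 1) = CentreBlowup.step p Finset.univ (j k) (b k) (c k) := fun k => (hw k).2.2.2.2
  have hdivk : ∀ k, ∀ e ∈ (c k).F.support, (c k).r ≤ e := IsolatedBand.isolated_chain_forall_le hc hr0
  have hord : ∀ m, k₀ ≤ m → ordZero (c m).F = (((c m).r.degree + d : ℕ) : ℕ∞) ∧ p < (c m).r.degree + d := by
    intro m hm
    obtain ⟨o, ho, hpo, -, hod⟩ := chain_shade_nat p hc hfloor hshade hm
    have hro := degree_r_le ho (hdivk m)
    refine ⟨?_, by omega⟩
    rw [ho]; congr 1; omega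
  -- (1) entry
  obtain ⟨k, hk, hsat⟩ := exists_satellite_ge p hc hw N
  obtain ⟨-, -, -, hTT, hclean⟩ := support_entry_of_satellite p hc hw hr0 hfloor hshade he (show k₀ ≤ k by omega) hsat
  set S : Finset (Fin 4) := (c (k + 2)).r.support with hS
  have hsupp : ∀ i, i ∉ S → (c (k + 2)).r i = 0 := fun i hi => Finsupp.notMem_support_iff.mp hi
  have hentry := SwapTransport.supportInv_refl p S hclean (hdivk (k + 2)) hsupp (hc (k + 2)).1 (he (k + 2) (by omega)) hTT
  -- (2) the virtual chain
  obtain ⟨c', j', b', h0, hInv, hc', hw', hr0', hfloor', hshade', he', hletters, hpass⟩ :=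
    support_virtual_chain (K := K) p S (d := d) (B₀ := c (k + 2))
      (Inv := fun t B => ∃ π : Equiv.Perm (Fin 4), (B.r = Finsupp.mapDomain (Equiv.symm π) (c (k + 2 + t)).r ∧
        (∀ i, i ∉ S → B.r i = 0) ∧ ordZero B.F = ordZero (c (k + 2 + t)).F ∧ B.shade = (c (k + 2 + t)).shade ∧
        (∀ d ∈ B.F.support, B.r ≤ d) ∧ IsIsolated p B.F ∧ Module.finrank K (ResCone.resVertex B) = 2 ∧
        (∀ v ∈ ResCone.resVertex B, (∀ i ∈ S, v i = 0) → v = 0) ∧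
        ∃ (Θ e : ℕ → Fin 4 → MvPolynomial (Fin 4) K), (∀ M k, Θ (M + 1) k - Θ M k ∈ originIdeal K ^ (M + 2)) ∧
          ∀ M, (∀ k, constantCoeff (Θ M k) = 0) ∧
            (∀ i, B.r i ≠ 0 → Θ M (π i) = X i * e M i ∧ constantCoeff (e M i) ≠ 0) ∧
            IsUnit (Matrix.det (Matrix.of fun k m => coeff (Finsupp.single m 1) (Θ M k))) ∧
            ∃ U E : MvPolynomial (Fin 4) K, constantCoeff U ≠ 0 ∧ E ∈ originIdeal K ^ M ∧
              B.F = deletePthPowers p (U ^ p * aeval (Θ M) (c (k + 2 + t)).F) + E))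
      ⟨1, hentry⟩
      (fun t B hB => by
        obtain ⟨π, hr, hconfB, hoB, -, hdivB, hisoB, heB, -, -⟩ := hB
        have hkt : k₀ ≤ k + 2 + t := by omega
        obtain ⟨ho, hpo⟩ := hord (k + 2 + t) hkt
        refine ⟨hisoB, ?_, ?_, heB, hconfB, hdivB⟩
        · rw [hoB, ho, hr, Finsupp.degree_mapDomain]
        · rw [hr, Finsupp.degree_mapDomain]; exact hpo)
      (fun t B hB => by
        obtain ⟨π, hinv⟩ := hB
        have hkt : k₀ ≤ k + 2 + t := by omega
        have hkt1 : k₀ ≤ k + 2 + t + 1 := by omega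
        obtain ⟨o, ho, hpo, ho2⟩ := chain_band p hc hfloor (k + 2 + t)
        obtain ⟨o', ho', hpo', ho2'⟩ := chain_band p hc hfloor (k + 2 + t + 1)
        have hsh : (c (k + 2 + t + 1)).shade = (c (k + 2 + t)).shade := by rw [hshade _ hkt1, hshade _ hkt]
        obtain ⟨ℓ, β, π', hℓ, hβ, hinv'⟩ := SwapTransport.support_virtual_step p S (c (k + 2 + t)) (c (k + 2 + t + 1)) B π
          (j (k + 2 + t)) (b (k + 2 + t)) (hw (k + 2 + t)).2.1 (hstep (k + 2 + t)) (hdivk _) (hdivk _) ⟨o, ho, hpo, ho2⟩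
          ⟨o', ho', hpo', ho2'⟩ hsh (hc (k + 2 + t + 1)).1 (he _ hkt1) hinv
        exact ⟨ℓ, β, hℓ, hβ, π', hinv'⟩)
  refine ⟨k + 2, c', j', b', by omega, h0, fun t => ?_, hpass, hletters, fun t => ?_, hc', hw', hr0', hfloor', hshade', he'⟩
  · obtain ⟨π, hr, -⟩ := hInv t
    exact ⟨π, hr⟩
  · obtain ⟨π, -, -, -, -, -, -, -, hTTt, -⟩ := hInv t
    exact hTTt

end ResCone

end Summit.ResolutionOfSingularities.ResolutionOfSingularities.Theorems.PIDim4

end
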